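import Summits.QuantumFields.BalabanUV.T4Continuum.Spine.NE1p.DressedRegenerationLinear
import Summits.QuantumFields.BalabanUV.T4Continuum.Spine.NE1p.DressedSmallFieldGeometryFaces

/-!
# T⁴ programme, spine estimate NE1′ (node O3b/H2) — THE LINEAR (SCHWARZ ∕ TOWER) REGENERATION CURRENCY ON THE TORUS OF THE PAPERS:
# S55's four (B1a)-discharged faces `‖E[act 1] − E[act 0]‖ ≤ (2M∕ε)·σ` — exp-linear families, (2.14)-cores, the substrate's slot activities,
# the Gaussian letters of record — at pv22's `tgeometry 4 N`: NO geometry hypothesis, constants LOCATED as numerals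
# (ν = 9, κ₀ = 64·log 162, K₀ = K₀(64,8), c₁ = 64, b₅ = 5·r₁)

Cell `pub-balaban`, sub-cell `t4`, BINDER-OWNERS row NE1′; NE1′ formalisation crew, unit `b2b-balaban-t4-ne1p-formalise-leaf-03`
(LEAF PROVER 03, generation 14); crew row S⟨next⟩ of `t4/formal/NE1p/LEAVES.md` (own-lineage follower of S55 `DressedRegenerationLinear` (p239807),
S52-B `DressedRegenerationOnCoresTorus` (p239279)'s pattern VERBATIM).  ADDITIVE — imports S55 `Spine/NE1p/DressedRegenerationLinear` (→ S46 → S42 →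
S33 → N0r∕…∕N0j → `DressedSmallFieldAllowance`; → S30 §1) and S24 `Spine/NE1p/DressedSmallFieldGeometryFaces` (`K₀_four`, →
`DressedSmallFieldGeometry.torus_consts`, pv22's `TreeLengthTorusGeometry`) ONLY; THEOREMS ONLY (0 def, 0 `def … : Prop`, 0 cite); nothing restated.

WHY THIS FILE.  S55 put the (B1a)-discharged (w5) END into the tower's `gen ≤ c·size` currency — the owner's Schwarz constant `c̄ = 2M∕ε`, free
of the content — at the four abstract-geometry levels; S52-B carries S52-A's Cauchy currency to pv22's torus.  This file is S55's torus column,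
by the SAME four specialisations as S52-B (`tsys 4 N` ∕ `tgeometry 4 N`, `b₅ := 5·r₁`, `torus_consts` ∕ `K₀_four`, `rw [hν, hc, hK₀] at h; exact h`):
* §0 `regenPart_locE_le_linear_of_expLinear_torus` (kernel; S55 §1 ONCE BY NAME).
* §1 `regenPart_locE_le_linear_of_coresAt_pencil_mass_torus` (kernel; S55 §2 ONCE BY NAME).
* §2 `regenPart_locE_le_linear_of_actOfLetters_torus` (kernel; S55 §3 ONCE BY NAME).
* §3 `regenPart_locE_le_linear_of_coreLettersOf_torus` (kernel; S55 §4 ONCE BY NAME).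
Every conclusion pins `locE (Dom := (tsys 4 N).Dom) …` — S31 ∕ S50-A ∕ S52-B's ELABORATION NOTE (the substrate's `Support/B13Carriers` in the cone
through S46 → S30 registers the global instance `TwoRuns.instDecidableEqTDom`; the bare `locE (TTouch …)` would elaborate with THAT instance and
stop being the by-name specialisation of S55, which elaborates `locE` CLASSICALLY; pinned, the statements PRINT as S37's and close by S55 BY NAME).

WHAT STAYS DISPLAYED (binders, by name; NOTHING instantiated on Bałaban's densities): as in S55 — `hroom`; the Gaussian letter blocks resp. (§3)
the substrate's primitive per-factor scalar letter conditions + CENTRE CONDITIONS + `hbud`∕`hmq`; `hO`∕`hH` at the ROOM `ε`; the content's size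
`0 < ‖v‖ < ε` (resp. `0 < σ < ε`); (B1b)'s residue `terms`∕`emb`∕`hscale` (§0: `hexp`, `hcurve`∕`hK`∕`hR`, `hact`, `hN`, the (2.38)-shape `hL3`);
(B3) = `hM3` — G-ne9p2-5, UNPRINTED, shared with NE9, a BINDER, never `[cite:`-tagged; the located clauses «κ large» `r₁ + 2·(64·log 162) + 2 ≤ R`
and «ε₁ small» `A·(e^{5r₁+1}·K₀(64,8)·9·64) ≤ 1` ((B5)-KIND SHAPES).  (B4) is discharged BY NAME on pv22's CONSTRUCTED torus geometry (pv22's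
READING of 𝐃_{k+1} ∕ d_{k+1}, DIVERGENCE D-pv22.3, not asserted here).

HONEST FRAMING.  By-name specialisation of S55 at a constructed geometry: KERNEL only RELATIVE TO the displayed inputs; `2M∕ε` is a READING of
the (w5) constant c̄ along the strength pencil (owner g31, journal l.21941 ∕ l.22720) — (B1a) discharged at the cores ∕ letters, (w5) NOT
discharged on Bałaban's densities; (B1b) ∕ (B3) ∕ (B5) NOT discharged; 0 binders instantiated on Bałaban's densities; no new inequality; no wall
item of NE1′ or NE5 moves; the NE1′ wall wording of record v1.8 (T4-DAG v48) — words, not kind — does NOT move; R-t4r2-Q2 NOT met; ABSOLUTE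
RULE honoured ([folklore] kernel lemmas only; no numeral of print; no disputed step of the audited manuscripts enters as a fact).  NE1′ ⇐ the
named binders — NOT proved, NOT printed; spine PROVED 0∕9; count 9 unchanged.  Rung (B)+1 on ONE finite four-torus — NOT infinite volume,
NOT a mass gap, NOT OS on ℝ⁴, NOT Clay.  HONEST DEPENDENCY: continuum YM on T⁴ ⇐ BetaPertH ∧ nine spine estimates (0/9 proved); BetaPertH ⇐
(D1) ∧ (D4) ∧ CAP+tail; G-an2-4 gates asym, D1 and NE2/3/4.
-/

noncomputable section

namespace Summit.QuantumFields.BalabanUV.T4Continuum.NE1p.DressedRegenerationLinearTorus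

open scoped BigOperators Matrix
open Metric Set MeasureTheory
open Literature.MathematicalPhysics.QuantumFieldTheory.Balaban1983to89
open Literature.MathematicalPhysics.QuantumFieldTheory.Balaban1983to89.T4OutputRate (Carriers)
open Literature.MathematicalPhysics.QuantumFieldTheory.Balaban1983to89.B13Resummation (locE)
open Literature.MathematicalPhysics.QuantumFieldTheory.Balaban1983to89.B5Prop11Lower (nsq)
open Literature.MathematicalPhysics.QuantumFieldTheory.Balaban1983to89.TreeLengthTorus (tsys torusTreeLen)
open Literature.MathematicalPhysics.QuantumFieldTheory.Balaban1983to89.TreeLengthTorusGeometry (TTouch tgeometry)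
open Literature.MathematicalPhysics.QuantumFieldTheory.Balaban1983to89.B12TreeDecay (K₀)
open Literature.MathematicalPhysics.QuantumFieldTheory.Balaban1983to89.T4InputCauchyRateTermwise (TermHistExpLinear)
open Summit.QuantumFields.BalabanUV.T4Continuum.B13HistMeasurable (MeasPotFrame B13HistM)
open Summit.QuantumFields.BalabanUV.T4Continuum.B13TermParamGaussianBi (BiCore)
open Summit.QuantumFields.BalabanUV.T4Continuum.SubstrateTwoRunsDriven (DrivenRuns)
open Summit.QuantumFields.BalabanUV.T4Continuum.SubstrateActivities (CoreLetters coreOf actOfLetters)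
open Summit.QuantumFields.BalabanUV.T4Continuum.SubstrateGaussianLetters (gaussC linForm)
open Summit.QuantumFields.BalabanUV.T4Continuum.SubstrateGaussianLettersBall (detBudget)
open Summit.QuantumFields.BalabanUV.T4Continuum.SubstrateSlotsOfRecord (ActLetters coreLettersOf)
open Summit.QuantumFields.BalabanUV.T4Continuum.NE1p.DressedRegenerationLinear (regenPart_locE_le_linear_of_expLinear
  regenPart_locE_le_linear_of_coresAt_pencil_mass regenPart_locE_le_linear_of_actOfLetters regenPart_locE_le_linear_of_coreLettersOf)
open Summit.QuantumFields.BalabanUV.T4Continuum.NE1p.DressedSmallFieldGeometry (torus_consts)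
open Summit.QuantumFields.BalabanUV.T4Continuum.NE1p.DressedSmallFieldGeometryFaces (K₀_four)

variable {N : ℕ} [NeZero N]

/-! ## §0 EXP-LINEAR FAMILIES ALONG THE STRENGTH CURVE, ON THE TORUS: the Schwarz currency `2·M∕ε·σ` -/

section ExpLinear

variable {C : Carriers} {Op Hist : Type*} [NormedAddCommGroup Hist] [NormedSpace ℂ Hist] {ι : Type*}
  {K : ℕ → (ℕ → ℝ) → C.BgB → Set (Op × Hist)} {T : ℕ → ι → Op → Hist → C.Dom → ℂ}
  {W : Set (ℕ → ℝ)} {α : ℕ → ι → Type*} [∀ k i, MeasurableSpace (α k i)] {μ : ∀ k i, Op → C.Dom → Measure (α k i)}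
  {Φ : ∀ k i, Op → C.Dom → α k i → ℂ} {Λ : ∀ k i, Op → C.Dom → α k i → (Hist →L[ℂ] ℂ)}

open Classical in
/-- **THE LINEAR (SCHWARZ ∕ TOWER) REGENERATION CURRENCY, (B1a) DISCHARGED, ON THE TORUS — NO GEOMETRY HYPOTHESIS** (kernel; S55 §1
`regenPart_locE_le_linear_of_expLinear` ONCE BY NAME at `tsys 4 N` ∕ `tgeometry 4 N`, `b₅ := 5·r₁`, constants located by `torus_consts` ∕
`K₀_four`; strength curve `hc : ℂ → Hist` on `‖s‖ < ε∕σ`, `0 < σ < ε`):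
`‖E[act 1](X₀) − E[act 0](X₀)‖ ≤ 2·(e·9·64·K₀(64,8)²·A·e^{−r₁·torusTreeLen X₀})∕ε·σ`. [folklore] -/
theorem regenPart_locE_le_linear_of_expLinear_torus (hexp : TermHistExpLinear K T W μ Φ Λ) {k : ℕ} {g : ℕ → ℝ} (hg : g ∈ W)
    {U : C.BgB} {o : Op} {hc : ℂ → Hist} {σ ε R₀ : ℝ} (hσ : 0 < σ) (hσε : σ < ε)
    (hcurve : DifferentiableOn ℂ hc (ball (0 : ℂ) (ε / σ)))
    (hK : ∀ s ∈ ball (0 : ℂ) (ε / σ), (o, hc s) ∈ K k g U) (hR : ∀ s ∈ ball (0 : ℂ) (ε / σ), ‖hc s‖ ≤ R₀)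
    {emb : (tsys 4 N).Dom → C.Dom} (hscale : ∀ Z, C.scale (emb Z) = k) {terms : (tsys 4 N).Dom → Finset ι}
    {act : ℂ → (tsys 4 N).Dom → ℂ} (hact : ∀ s ∈ ball (0 : ℂ) (ε / σ), ∀ Z, act s Z = ∑ i ∈ terms Z, T k i o (hc s) (emb Z))
    {N' : (tsys 4 N).Dom → ι → ℝ} (hN0 : ∀ Z i, 0 ≤ N' Z i)
    (hN : ∀ Z, ∀ i ∈ terms Z, ∀ᵐ a ∂μ k i o (emb Z), ‖Λ k i o (emb Z) a‖ ≤ N' Z i)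
    {A R r₁ : ℝ} (X₀ : (tsys 4 N).Dom) (hA : 0 ≤ A) (hr₁ : 0 ≤ r₁)
    (hrate : r₁ + 2 * (64 * Real.log 162) + 2 ≤ R) (hsmall : A * Real.exp (5 * r₁ + 1) * K₀ 64 8 * 9 * 64 ≤ 1)
    (hL3 : ∀ Z : (tsys 4 N).Dom, Z.1 ⊆ X₀.1 →
      ∑ i ∈ terms Z, (∫ a, ‖Φ k i o (emb Z) a‖ ∂μ k i o (emb Z)) * Real.exp (N' Z i * R₀) ≤
        A * Real.exp (-(R * torusTreeLen Z.1))) :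
    ‖locE (Dom := (tsys 4 N).Dom) (TTouch (d := 4) (N := N)) (fun Z : (tsys 4 N).Dom => Z.1) (act 1) X₀.1 -
        locE (Dom := (tsys 4 N).Dom) (TTouch (d := 4) (N := N)) (fun Z : (tsys 4 N).Dom => Z.1) (act 0) X₀.1‖ ≤
      2 * (Real.exp 1 * 9 * 64 * K₀ 64 8 ^ 2 * A * Real.exp (-(r₁ * torusTreeLen X₀.1))) / ε * σ := by
  obtain ⟨hν, hκ, hc'⟩ := torus_consts N
  have hK₀ := K₀_four (N := N)
  have h := regenPart_locE_le_linear_of_expLinear (tsys 4 N) (tgeometry 4 N) hexp hg hσ hσε hcurve hK hR hscale hact hN0 hN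
    (R := R) (b₅ := 5 * r₁) (X₀ := X₀) hA hr₁ (le_of_eq (by ring)) (by rw [hκ]; exact hrate)
    (by rw [hK₀, hν, hc']; exact hsmall) hL3
  rw [hν, hc', hK₀] at h
  exact h

end ExpLinear

/-! ## §1 CORES WITH TERM-DEPENDENT POLYMER FAMILIES, ON THE TORUS: linear in `‖v‖` -/

section Dep

variable {C : Carriers} {P : MeasPotFrame C} {Op : Type*} [NormedAddCommGroup Op] [NormedSpace ℂ Op] {ι : Type*}
  {𝒴 : ℕ → ι → Type*} {dom : ∀ k i, 𝒴 k i → C.Dom} {β : ℕ → ι → Type*} [∀ k i, MeasurableSpace (β k i)]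
  {α : ℕ → ι → Type*} [∀ k i, NormedAddCommGroup (α k i)] [∀ k i, InnerProductSpace ℝ (α k i)]
  [∀ k i, FiniteDimensional ℝ (α k i)] [∀ k i, MeasurableSpace (α k i)] [∀ k i, BorelSpace (α k i)]

open Classical in
/-- **THE REGENERATION IS LINEAR IN THE CONTENT'S SIZE — CORES WITH TERM-DEPENDENT POLYMER FAMILIES, ON THE TORUS — NO GEOMETRY
HYPOTHESIS** (kernel; S55 §2 `regenPart_locE_le_linear_of_coresAt_pencil_mass` ONCE BY NAME at `tsys 4 N` ∕ `tgeometry 4 N`, `b₅ := 5·r₁`,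
constants located by `torus_consts` ∕ `K₀_four`): for `0 < ‖v‖ < ε`,
`‖E[act 1](X₀) − E[act 0](X₀)‖ ≤ 2·(e·9·64·K₀(64,8)²·A·e^{−r₁·torusTreeLen X₀})∕ε·‖v‖`. [folklore] -/
theorem regenPart_locE_le_linear_of_coresAt_pencil_mass_torus {W : Set (ℕ → ℝ)}
    {ctr : ℕ → (ℕ → ℝ) → C.BgB → Op × B13HistM P} {ROp RHist R' : ℕ → ℝ}
    (𝔊 : ∀ k i, C.Dom → BiCore P (dom k i) Op (β k i) (α k i)) {mq bq N₀ : ℕ → ι → C.Dom → ℝ} (hroom : ∀ k, ROp k < R' k)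
    (hm : ∀ k, ∀ g ∈ W, ∀ (U : C.BgB) (X : C.Dom), C.scale X = k → ∀ i, 0 < mq k i X)
    (hN : ∀ k, ∀ g ∈ W, ∀ (U : C.BgB) (X : C.Dom), C.scale X = k → ∀ i,
      (∀ o ∈ ball (ctr k g U).1 (R' k), AEStronglyMeasurable ((𝔊 k i X).N o) (𝔊 k i X).lam) ∧
      (∀ p, DifferentiableOn ℂ (fun o => (𝔊 k i X).N o p) (ball (ctr k g U).1 (R' k))) ∧
      (∀ o ∈ ball (ctr k g U).1 (R' k), ∀ p, ‖(𝔊 k i X).N o p‖ ≤ N₀ k i X))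
    (hq : ∀ k, ∀ g ∈ W, ∀ (U : C.BgB) (X : C.Dom), C.scale X = k → ∀ i,
      (∀ o ∈ ball (ctr k g U).1 (R' k),
        AEStronglyMeasurable (Function.uncurry ((𝔊 k i X).q o)) ((𝔊 k i X).lam.prod volume)) ∧
      (∀ p v, DifferentiableOn ℂ (fun o => (𝔊 k i X).q o p v) (ball (ctr k g U).1 (R' k))) ∧
      (∀ o ∈ ball (ctr k g U).1 (R' k), ∀ p v, mq k i X * ‖v‖ ^ 2 - bq k i X ≤ ((𝔊 k i X).q o p v).re))
    {k : ℕ} {g : ℕ → ℝ} (hg : g ∈ W) {U : C.BgB} {o : Op} {h₀ v : B13HistM P} {ε : ℝ} (hv : 0 < ‖v‖) (hvε : ‖v‖ < ε)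
    (hO : ‖o - (ctr k g U).1‖ ≤ ROp k) (hH : ‖h₀ - (ctr k g U).2‖ + ε ≤ RHist k)
    {emb : (tsys 4 N).Dom → C.Dom} (hscale : ∀ Z, C.scale (emb Z) = k) {terms : (tsys 4 N).Dom → Finset ι}
    {act : ℂ → (tsys 4 N).Dom → ℂ}
    (hact : ∀ s ∈ ball (0 : ℂ) (ε / ‖v‖), ∀ Z, act s Z = ∑ i ∈ terms Z, (𝔊 k i (emb Z)).termAt o (h₀ + s • v))
    {A R r₁ : ℝ} (X₀ : (tsys 4 N).Dom) (hA : 0 ≤ A) (hr₁ : 0 ≤ r₁)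
    (hrate : r₁ + 2 * (64 * Real.log 162) + 2 ≤ R) (hsmall : A * Real.exp (5 * r₁ + 1) * K₀ 64 8 * 9 * 64 ≤ 1)
    (hM3 : ∀ Z : (tsys 4 N).Dom, Z.1 ⊆ X₀.1 →
      ∑ i ∈ terms Z, (𝔊 k i (emb Z)).lam.real univ * ((𝔊 k i (emb Z)).wB * N₀ k i (emb Z) *
          Real.exp (bq k i (emb Z))) * (Real.pi / (mq k i (emb Z) / 2)) ^ (Module.finrank ℝ (α k i) / 2 : ℝ) *
        Real.exp ((𝔊 k i (emb Z)).N₁ * (‖h₀‖ + ε)) ≤ A * Real.exp (-(R * torusTreeLen Z.1))) :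
    ‖locE (Dom := (tsys 4 N).Dom) (TTouch (d := 4) (N := N)) (fun Z : (tsys 4 N).Dom => Z.1) (act 1) X₀.1 -
        locE (Dom := (tsys 4 N).Dom) (TTouch (d := 4) (N := N)) (fun Z : (tsys 4 N).Dom => Z.1) (act 0) X₀.1‖ ≤
      2 * (Real.exp 1 * 9 * 64 * K₀ 64 8 ^ 2 * A * Real.exp (-(r₁ * torusTreeLen X₀.1))) / ε * ‖v‖ := by
  obtain ⟨hν, hκ, hc⟩ := torus_consts N
  have hK₀ := K₀_four (N := N)
  have h := regenPart_locE_le_linear_of_coresAt_pencil_mass (tsys 4 N) (tgeometry 4 N) 𝔊 hroom hm hN hq hg hv hvε hO hH hscale hact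
    (R := R) (b₅ := 5 * r₁) (X₀ := X₀) hA hr₁ (le_of_eq (by ring)) (by rw [hκ]; exact hrate)
    (by rw [hK₀, hν, hc]; exact hsmall) hM3
  rw [hν, hc, hK₀] at h
  exact h

end Dep

/-! ## §2 THE SUBSTRATE'S SLOT ACTIVITIES ALONG THE STRENGTH PENCIL, ON THE TORUS -/

section Slot

variable {C : Carriers} (P : MeasPotFrame C) (Op : Type*) [NormedAddCommGroup Op] [NormedSpace ℂ Op] {Pol J : Type*}
  (𝒴 : Pol → J → Type) [∀ Z j, Fintype (𝒴 Z j)] (dom : ∀ Z j, 𝒴 Z j → C.Dom)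
  (Jc : Pol → J → Type) [∀ Z j, Fintype (Jc Z j)]
  (V : Pol → J → Type) [∀ Z j, NormedAddCommGroup (V Z j)] [∀ Z j, InnerProductSpace ℝ (V Z j)]
  [∀ Z j, MeasurableSpace (V Z j)] [∀ Z j, BorelSpace (V Z j)] [∀ Z j, FiniteDimensional ℝ (V Z j)]

open Classical in
/-- **THE REGENERATION IS LINEAR IN THE CONTENT'S SIZE — THE SLOT ACTIVITIES, ON THE TORUS — NO GEOMETRY HYPOTHESIS** (kernel; S55 §3
`regenPart_locE_le_linear_of_actOfLetters` ONCE BY NAME at `tgeometry 4 N`, constants located). [folklore] -/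
theorem regenPart_locE_le_linear_of_actOfLetters_torus {W : Set (ℕ → ℝ)}
    {ctr : ℕ → (ℕ → ℝ) → C.BgB → Op × B13HistM P} {ROp RHist R' : ℕ → ℝ} (ℓ : ∀ Z j, CoreLetters P Op 𝒴 dom Jc V Z j)
    {mq bq N₀ : ℕ → Pol × J → C.Dom → ℝ}
    (hroom : ∀ k, ROp k < R' k) (hm : ∀ k, ∀ g ∈ W, ∀ (U : C.BgB) (X : C.Dom), C.scale X = k → ∀ p, 0 < mq k p X)
    (hN : ∀ k, ∀ g ∈ W, ∀ (U : C.BgB) (X : C.Dom), C.scale X = k → ∀ p : Pol × J,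
      (∀ o ∈ ball (ctr k g U).1 (R' k),
        AEStronglyMeasurable ((ℓ p.1 p.2).N o) (coreOf P Op 𝒴 dom Jc V ℓ p.1 p.2).lam) ∧
      (∀ a, DifferentiableOn ℂ (fun o => (ℓ p.1 p.2).N o a) (ball (ctr k g U).1 (R' k))) ∧
      (∀ o ∈ ball (ctr k g U).1 (R' k), ∀ a, ‖(ℓ p.1 p.2).N o a‖ ≤ N₀ k p X))
    (hq : ∀ k, ∀ g ∈ W, ∀ (U : C.BgB) (X : C.Dom), C.scale X = k → ∀ p : Pol × J,
      (∀ o ∈ ball (ctr k g U).1 (R' k),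
        AEStronglyMeasurable (Function.uncurry ((ℓ p.1 p.2).q o))
          ((coreOf P Op 𝒴 dom Jc V ℓ p.1 p.2).lam.prod volume)) ∧
      (∀ a v, DifferentiableOn ℂ (fun o => (ℓ p.1 p.2).q o a v) (ball (ctr k g U).1 (R' k))) ∧
      (∀ o ∈ ball (ctr k g U).1 (R' k), ∀ a v, mq k p X * ‖v‖ ^ 2 - bq k p X ≤ ((ℓ p.1 p.2).q o a v).re))
    {k : ℕ} {g : ℕ → ℝ} (hg : g ∈ W) {U : C.BgB} {o : Op} {h₀ v : B13HistM P} {ε : ℝ} (hv : 0 < ‖v‖) (hvε : ‖v‖ < ε)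
    (hO : ‖o - (ctr k g U).1‖ ≤ ROp k) (hH : ‖h₀ - (ctr k g U).2‖ + ε ≤ RHist k)
    {emb : (tsys 4 N).Dom → C.Dom} (hscale : ∀ Z, C.scale (emb Z) = k) (terms : (tsys 4 N).Dom → Finset (Pol × J))
    {A R r₁ : ℝ} (X₀ : (tsys 4 N).Dom) (hA : 0 ≤ A) (hr₁ : 0 ≤ r₁)
    (hrate : r₁ + 2 * (64 * Real.log 162) + 2 ≤ R) (hsmall : A * Real.exp (5 * r₁ + 1) * K₀ 64 8 * 9 * 64 ≤ 1)
    (hM3 : ∀ Z : (tsys 4 N).Dom, Z.1 ⊆ X₀.1 →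
      ∑ p ∈ terms Z, (coreOf P Op 𝒴 dom Jc V ℓ p.1 p.2).lam.real univ *
          ((coreOf P Op 𝒴 dom Jc V ℓ p.1 p.2).wB * N₀ k p (emb Z) * Real.exp (bq k p (emb Z))) *
          (Real.pi / (mq k p (emb Z) / 2)) ^ (Module.finrank ℝ (V p.1 p.2) / 2 : ℝ) *
        Real.exp ((coreOf P Op 𝒴 dom Jc V ℓ p.1 p.2).N₁ * (‖h₀‖ + ε)) ≤ A * Real.exp (-(R * torusTreeLen Z.1))) :
    ‖locE (Dom := (tsys 4 N).Dom) (TTouch (d := 4) (N := N)) (fun Z : (tsys 4 N).Dom => Z.1)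
          (fun Z => ∑ p ∈ terms Z, actOfLetters P Op 𝒴 dom Jc V ℓ p.1 p.2 o (h₀ + (1 : ℂ) • v)) X₀.1 -
        locE (Dom := (tsys 4 N).Dom) (TTouch (d := 4) (N := N)) (fun Z : (tsys 4 N).Dom => Z.1)
          (fun Z => ∑ p ∈ terms Z, actOfLetters P Op 𝒴 dom Jc V ℓ p.1 p.2 o (h₀ + (0 : ℂ) • v)) X₀.1‖ ≤
      2 * (Real.exp 1 * 9 * 64 * K₀ 64 8 ^ 2 * A * Real.exp (-(r₁ * torusTreeLen X₀.1))) / ε * ‖v‖ := by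
  obtain ⟨hν, hκ, hc⟩ := torus_consts N
  have hK₀ := K₀_four (N := N)
  have h := regenPart_locE_le_linear_of_actOfLetters P Op 𝒴 dom Jc V (tsys 4 N) (tgeometry 4 N) ℓ hroom hm hN hq hg hv hvε hO hH
    hscale terms
    (R := R) (b₅ := 5 * r₁) (X₀ := X₀) hA hr₁ (le_of_eq (by ring)) (by rw [hκ]; exact hrate)
    (by rw [hK₀, hν, hc]; exact hsmall) hM3
  rw [hν, hc, hK₀] at h
  exact h

end Slot

/-! ## §3 THE GAUSSIAN LETTERS OF RECORD `coreLettersOf A` ALONG THE STRENGTH PENCIL, ON THE TORUS -/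

section CoreLettersOf

variable {G : Type} [GaugeGroup G] (D : DrivenRuns G) (P : MeasPotFrame D.carriers)
variable (Op : Type) [NormedAddCommGroup Op] [NormedSpace ℂ Op] {J : Type}
  (𝒵 : D.carriers.Dom → J → Type) [∀ Z j, Fintype (𝒵 Z j)] (dom : ∀ Z j, 𝒵 Z j → D.carriers.Dom)
  (Jc : D.carriers.Dom → J → Type) [∀ Z j, Fintype (Jc Z j)]
  (V : D.carriers.Dom → J → Type) [∀ Z j, NormedAddCommGroup (V Z j)] [∀ Z j, InnerProductSpace ℝ (V Z j)]
  [∀ Z j, MeasurableSpace (V Z j)] [∀ Z j, BorelSpace (V Z j)] [∀ Z j, FiniteDimensional ℝ (V Z j)]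
  (mI : D.carriers.Dom → J → Type) [∀ Z j, Fintype (mI Z j)] [∀ Z j, DecidableEq (mI Z j)]

open Classical in
/-- **THE REGENERATION IS LINEAR IN THE CONTENT'S SIZE — AT THE CORE LETTERS OF RECORD, ON THE TORUS — NO GEOMETRY HYPOTHESIS,
OPERATOR LETTERS DISCHARGED** (kernel; S55 §4 `regenPart_locE_le_linear_of_coreLettersOf` ONCE BY NAME at `tsys 4 N` ∕ `tgeometry 4 N`,
`b₅ := 5·r₁`, constants located by `torus_consts` ∕ `K₀_four`):
`‖E[Σ actOfLetters (coreLettersOf A) … o (h₀ + v)](X₀) − E[… o h₀](X₀)‖ ≤ 2·(e·9·64·K₀(64,8)²·A′·e^{−r₁·torusTreeLen X₀})∕ε·‖v‖`. [folklore] -/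
theorem regenPart_locE_le_linear_of_coreLettersOf_torus {W : Set (ℕ → ℝ)} {ctr : ℕ → (ℕ → ℝ) → D.carriers.BgB → Op × B13HistM P}
    {ROp RHist R' : ℕ → ℝ} (A : ∀ Z j, ActLetters D P Op 𝒵 dom Jc V mI Z j) {β₀ ϑ d₀ γ : D.carriers.Dom → J → ℝ}
    (hroom : ∀ k, ROp k < R' k) (hR' : ∀ k, 0 ≤ R' k)
    (hbase : ∀ Z j ii jj, Measurable fun a => (A Z j).base a ii jj)
    (hrdm : ∀ Z j ii jj (o' : Op), Measurable fun a => (A Z j).rd a ii jj o')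
    (hβ₀ : ∀ Z j, 0 ≤ β₀ Z j) (hd₀ : ∀ Z j, 0 < d₀ Z j)
    (hrd : ∀ Z j a ii jj, ‖(A Z j).rd a ii jj‖ ≤ ϑ Z j)
    (hctr : ∀ k, ∀ g ∈ W, ∀ (U : D.carriers.BgB) (Z : D.carriers.Dom) (j : J) (a : (Jc Z j ⊕ 𝒵 Z j) → ℝ × ℝ),
      (∀ ii jj, ‖linForm (A Z j).base (A Z j).rd (ctr k g U).1 a ii jj‖ ≤ β₀ Z j) ∧
      ((linForm (A Z j).base (A Z j).rd (ctr k g U).1 a).det).im = 0 ∧ d₀ Z j ≤ ((linForm (A Z j).base (A Z j).rd (ctr k g U).1 a).det).re ∧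
      (∀ x : mI Z j → ℂ, γ Z j * nsq x ≤ (star x ⬝ᵥ (linForm (A Z j).base (A Z j).rd (ctr k g U).1 a *ᵥ x)).re))
    (hbud : ∀ k Z j, detBudget (Fintype.card (mI Z j)) (β₀ Z j) (ϑ Z j) (R' k) < d₀ Z j)
    (hmq : ∀ k Z j, Fintype.card (mI Z j) * ϑ Z j * R' k < γ Z j)
    {k : ℕ} {g : ℕ → ℝ} (hg : g ∈ W) {U : D.carriers.BgB} {o : Op} {h₀ v : B13HistM P} {ε : ℝ} (hv : 0 < ‖v‖) (hvε : ‖v‖ < ε)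
    (hO : ‖o - (ctr k g U).1‖ ≤ ROp k) (hH : ‖h₀ - (ctr k g U).2‖ + ε ≤ RHist k)
    {emb : (tsys 4 N).Dom → D.carriers.Dom} (hscale : ∀ Z, D.carriers.scale (emb Z) = k)
    (terms : (tsys 4 N).Dom → Finset (D.carriers.Dom × J))
    {A' R r₁ : ℝ} (X₀ : (tsys 4 N).Dom) (hA : 0 ≤ A') (hr₁ : 0 ≤ r₁)
    (hrate : r₁ + 2 * (64 * Real.log 162) + 2 ≤ R) (hsmall : A' * Real.exp (5 * r₁ + 1) * K₀ 64 8 * 9 * 64 ≤ 1)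
    (hM3 : ∀ Z : (tsys 4 N).Dom, Z.1 ⊆ X₀.1 →
      ∑ p ∈ terms Z, (coreOf P Op 𝒵 dom Jc V (coreLettersOf D P Op 𝒵 dom Jc V mI A) p.1 p.2).lam.real univ *
          ((coreOf P Op 𝒵 dom Jc V (coreLettersOf D P Op 𝒵 dom Jc V mI A) p.1 p.2).wB *
              (gaussC (mI p.1 p.2) * Real.sqrt (max 1 ((Fintype.card (mI p.1 p.2)).factorial *
                β₀ p.1 p.2 ^ Fintype.card (mI p.1 p.2) + d₀ p.1 p.2))) * Real.exp 0) *
          (Real.pi / ((γ p.1 p.2 - Fintype.card (mI p.1 p.2) * ϑ p.1 p.2 * R' k) / 2 / 2)) ^ (Module.finrank ℝ (V p.1 p.2) / 2 : ℝ) *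
        Real.exp ((coreOf P Op 𝒵 dom Jc V (coreLettersOf D P Op 𝒵 dom Jc V mI A) p.1 p.2).N₁ * (‖h₀‖ + ε)) ≤
        A' * Real.exp (-(R * torusTreeLen Z.1))) :
    ‖locE (Dom := (tsys 4 N).Dom) (TTouch (d := 4) (N := N)) (fun Z : (tsys 4 N).Dom => Z.1) (fun Z => ∑ p ∈ terms Z,
          actOfLetters P Op 𝒵 dom Jc V (coreLettersOf D P Op 𝒵 dom Jc V mI A) p.1 p.2 o (h₀ + (1 : ℂ) • v)) X₀.1 -
        locE (Dom := (tsys 4 N).Dom) (TTouch (d := 4) (N := N)) (fun Z : (tsys 4 N).Dom => Z.1) (fun Z => ∑ p ∈ terms Z,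
          actOfLetters P Op 𝒵 dom Jc V (coreLettersOf D P Op 𝒵 dom Jc V mI A) p.1 p.2 o (h₀ + (0 : ℂ) • v)) X₀.1‖ ≤
      2 * (Real.exp 1 * 9 * 64 * K₀ 64 8 ^ 2 * A' * Real.exp (-(r₁ * torusTreeLen X₀.1))) / ε * ‖v‖ := by
  obtain ⟨hν, hκ, hc⟩ := torus_consts N
  have hK₀ := K₀_four (N := N)
  have h := regenPart_locE_le_linear_of_coreLettersOf D P Op 𝒵 dom Jc V mI (tsys 4 N) (tgeometry 4 N) A hroom hR' hbase hrdm hβ₀ hd₀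
    hrd hctr hbud hmq hg hv hvε hO hH hscale terms (R := R) (b₅ := 5 * r₁) (X₀ := X₀) hA hr₁ (le_of_eq (by ring))
    (by rw [hκ]; exact hrate) (by rw [hK₀, hν, hc]; exact hsmall) hM3
  rw [hν, hc, hK₀] at h
  exact h

end CoreLettersOf

end Summit.QuantumFields.BalabanUV.T4Continuum.NE1p.DressedRegenerationLinearTorus

end
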